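import Summits.QuantumFields.YangMills.Theorems.BalabanUVNodesN11Thm2AlongSupplyChain

/-!
# DAG node N11 — [III] (2.49) ALONG THE WITNESS CHAIN AT THE BACKGROUNDS OF A READING SUPPORT, the regularity class read off def-R's ROW `bg` (`BgProvisoΛ`): every token of
# g2's chain edge is now a NAMED row of the node — def-T's provisos, the live selector, the supplier's obligations (dag-n11-e), row `bg` (def-R ∕ K0b ∕ dag-n11-d's editions),
# Theorem 2 keyed to the chain at that class (the cell's `def … : Prop`), (2.46)'s coupling inputs and the vacuum sentence

Cell `pub-ymgap`, YM-PLAN Track A (HUMAN RULING D-0062 ∕ D-0149), seat `pub-ymgap-dag-n11-w2` (g2), route `BalabanUVNodes`, key item K1⁷ `StabilityBAtRecordR13SepCoPH` =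
stmt-QuantumFields-20542 (helper, count-neutral).  [III] = [Balaban1988Convergent].  Over g2's `…Thm2AlongSupplyChain` (INTENT-5) and def-R's `Node00.BgProvisoRangedOfRecord`
(`BgProvisoΛ`; `Stage13HParams.bgProvisoΛ_rzAt_iff` of def-T's `Record13CoPH`).

WHY THIS FILE.  g2's chain edge `ineq249_action23_chainWitness_of_obligations` asks the configuration class `𝒰` to be (2.41)(ii)-regular through a displayed inclusion `h𝒰`.  At
NODE 00 the configurations print means («U_k = U_k(V), e.g. for V restricted by the characteristic functions in (2.18)», p. 263 L14) are the values `U s W` of a background map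
`U : SeqOfRecord … k → BgMap` on a reading support `Supp s` (e.g. def-T's `UbgOfRecord₁₃CoP … k` on the charged reading support of dag-n11-d's `…SpaceTruncationCharged`), and
their regularity IS def-R's ROW `bg`: `BgProvisoΛ F N p.K S Rz M k Supp U` — conjunct 2 «`(ι(U s W), 0) ∈ Ũ^c_j(X)` whenever `X` is (2.41)(i)-admissible» (print-true by [14],
[15], (2.7); DISPLAYED in the tree, never asserted).  THIS FILE reads `h𝒰` off row `bg` for the class `𝒰 k s := (U k s) '' (Supp k s)` (the backgrounds of the support) — the
residual switch `θ.Rz p.K ↔ θ.rzAt p s` is def-T's `Iff.rfl` — and restates the chain edge with the class hypothesis replaced by the row.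

WHAT THIS FILE PROVES (0 `sorry`, 0 `def`, standard axioms; count-neutral; nothing of Bałaban's asserted).
`regular_of_bgProvisoΛ` (row `bg` at every level ⇒ §3's inclusion `h𝒰` for the class of backgrounds of the support) · ★★ `ineq249_action23_chainWitness_at_backgrounds_of_obligations`
(= INTENT-5's `…_of_obligations` at that class: `Provisos₁₃CoPH`, `hsel`, `Admissible`, signs, `1 ≤ M`, `(hσ, hT)`, row `bg` at every level, Theorem 2 keyed to the chain at the
backgrounds, `0 < β < 1`, `1 < L`, `κ₀ ≥ 7`, `H033`, `g_j ≥ 0`, `κ₀(4·2^d,2d) ≤ θ.s2.lf.κ` ⇒ `∃ E₁ R₁ ≥ 0`, ∀ k ≤ K, s, W ∈ Supp k s, volumes, (2.46)'s inputs, vacuum ⇒ (2.49) for the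
chain's (2.23)-action AT `U k s W`).

HONEST FRAMING.  Kernel composition; row `bg`, the obligations, Theorem 2 (keyed) and the provisos are HYPOTHESES in the node's own tokens; nothing of Bałaban asserted; N11 NOT
discharged; K1⁷ NOT closed; counts unmoved (typed 28∕28 · discharged 5∕27).  One finite four-torus programme at fixed `ε = L^{−K}`; R4 closes only the conditional finite-𝕋⁴
rung `BalabanLadder.UV`; NOT ℝ⁴, NOT OS, NOT the Yang–Mills mass gap (Clay), which none of this proves.
Sources: [III] Thm 2 p.263 L14, (2.41) p.261, (2.49) p.264, (2.19) p.258, (2.12)–(2.16) pp.256–257.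
-/

noncomputable section

open scoped BigOperators Matrix.Norms.L2Operator

namespace Summit.QuantumFields.YangMills.Theorems.BalabanUVNodesN11Thm2AlongSupplyChainAtBackgrounds

open Literature.MathematicalPhysics.QuantumFieldTheory.Balaban1983to89 Step B14.Eq225Concrete B14.LocalCoupling B14Thm2 B12TreeDecay TreeLengthTorus Finset
open T4Continuum Node00 B15DeterminingSets
open B10Eq38TorusDomains (toFine)
open BalabanUVNodesN11Sect3SupplyChainDefs (Sect3Supplier chainWitness)
open BalabanUVNodesN11Sect3SupplyChainObligationsDefs (SupplierObligations NoExpansionObligation)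
open BalabanUVNodesN11Thm2Sect2DataOfRecordKeyedDefs (sect2DataOfRecord₁₃Keyed)
open BalabanUVNodesN11Thm2AlongSupplyChain (ineq249_action23_chainWitness_of_obligations)

variable {F : T4Family} {N : ℕ} [NeZero N]
variable (θ : Stage13HParams F N) (p : B12.RunParams)
variable (Supp : (k : ℕ) → SeqOfRecord F θ.ν θ.τ9.M (gOfRecord₁₃ F N θ.toStage13Params p) p.K k → Set (MSField (F.P p.K) (SU N)))
variable (Ubg : (k : ℕ) → SeqOfRecord F θ.ν θ.τ9.M (gOfRecord₁₃ F N θ.toStage13Params p) p.K k → BgMap F N p.K)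

/-- **ROW `bg` ⇒ THE BACKGROUNDS OF THE SUPPORT ARE (2.41)(ii)-REGULAR** (g2 INTENT-5's inclusion `h𝒰` for the class `𝒰 k s := (U k s) '' (Supp k s)`): conjunct 2 of def-R's
`BgProvisoΛ` at every level, the residual switched from `θ.Rz p.K` to the history's `θ.rzAt p s` by def-T's `Iff.rfl`. [cite: Balaban1988Convergent, (2.41) p.261, Thm 2 p.263 L14] -/
theorem regular_of_bgProvisoΛ
    (hbg : ∀ k, BgProvisoΛ F N p.K (settingOfRecord₁₃ F N θ.toStage13Params p) (θ.Rz p.K) θ.τ9.M k (Supp k) (Ubg k)) :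
    ∀ k (s : SeqOfRecord F θ.ν θ.τ9.M (gOfRecord₁₃ F N θ.toStage13Params p) p.K k) (U : GaugeField (F.P p.K) 0 (SU N)),
      U ∈ (fun k s => Ubg k s '' Supp k s) k s →
      ∀ j, 1 ≤ j → j ≤ k → ∀ X, Sect2.admB (F.P p.K) θ.ν θ.τ9.M (gOfRecord₁₃ F N θ.toStage13Params p) s.Ω s.Λ j (Sect2.domSites (F.P p.K) θ.τ9.M j X) = true →
        Sect2.ofBackgroundC (ιSU N) U ∈ Sect2.spaceMS (settingOfRecord₁₃ F N θ.toStage13Params p) (θ.rzAt p s) θ.τ9.M j (Sect2.domSites (F.P p.K) θ.τ9.M j X) s.Ω := by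
  intro k s U hU j hj hjk X hX
  obtain ⟨W, hW, rfl⟩ := hU
  have h := ((θ.bgProvisoΛ_rzAt_iff p s (settingOfRecord₁₃ F N θ.toStage13Params p) θ.τ9.M k (Supp k) (Ubg k)).mpr (hbg k)) s W hW j hj hjk X
  exact h.2 hX

open Classical in
/-- **★★ (2.49) ALONG THE WITNESS CHAIN AT THE BACKGROUNDS OF THE SUPPORT, EVERY TOKEN A NAMED ROW**: def-T's provisos + live selector + admissibility + signs, the supplier's
obligations `(hσ, hT)` (dag-n11-e), def-R's row `bg` at every level, Theorem 2 keyed to the chain at the backgrounds (g2 INTENT-2's carrier), `0 < β < 1`, `1 < L`, `κ₀ ≥ 7`,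
`H033` at the run's flow, `g_j ≥ 0`, `κ₀(4·2^d,2d) ≤ θ.s2.lf.κ` ⇒ `∃ E₁ R₁ ≥ 0` such that for every `k ≤ K`, history `s`, `W ∈ Supp k s`, volumes `Γ_n` dominating `|Γ_n(s)|` and
`#ring_n(s)`, (2.46)'s inputs and the vacuum sentence: (2.49) for the chain's (2.23)-action at `U k s W`. [cite: Balaban1988Convergent, Thm 2 p.263, (2.49) p.264, (2.41)–(2.42) p.261, §3 p.279] -/
theorem ineq249_action23_chainWitness_at_backgrounds_of_obligations (σ : Sect3Supplier θ p) (hprov : θ.Provisos₁₃CoPH F N)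
    (hsel : θ.ppSel = ppSelLiveOfRecord F N θ.ν θ.τ9 (EOfRecord₁₃ F N θ.toStage13Params) (wOfRecord₉ F N θ.toStage9Params))
    (hθ : θ.Admissible F N) (hE₀ : 0 ≤ θ.s2.lf.E₀) (hB₀ : 0 ≤ θ.s2.lf.B₀) (hM : 1 ≤ θ.τ9.M)
    (hκ : kappa₀ (4 * 2 ^ (F.P p.K).d) (2 * (F.P p.K).d) ≤ θ.s2.lf.κ)
    (hσ : SupplierObligations θ p σ) (hT : NoExpansionObligation θ p σ)
    (hbg : ∀ k, BgProvisoΛ F N p.K (settingOfRecord₁₃ F N θ.toStage13Params p) (θ.Rz p.K) θ.τ9.M k (Supp k) (Ubg k))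
    (H033 : Flow → ℕ → Prop) {L β : ℝ} {κ₀ : ℕ}
    (hT2 : B14.Thm2Printed H033 (fun _ : PUnit => sect2DataOfRecord₁₃Keyed θ p (fun k s => (chainWitness θ p σ k).1 s) (fun k s => Ubg k s '' Supp k s)) L β κ₀)
    (hβ1 : β < 1) (hβ0 : 0 < β) (hL : 1 < L) (hκ7 : 7 ≤ κ₀)
    (h033 : H033 (flowOfRun (gOfRecord₁₃ F N θ.toStage13Params p)) p.K) (hg : ∀ j, j ≤ p.K → 0 ≤ gOfRecord₁₃ F N θ.toStage13Params p j) :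
    ∃ E₁ R₁ : ℝ, 0 ≤ E₁ ∧ 0 ≤ R₁ ∧
      ∀ k, k ≤ p.K → ∀ (s : SeqOfRecord F θ.ν θ.τ9.M (gOfRecord₁₃ F N θ.toStage13Params p) p.K k) (W : MSField (F.P p.K) (SU N)), W ∈ Supp k s →
      ∀ (a : Tk.SFluct (F.P p.K) (FluctV N)) (Ek EkLog EkRest : ℝ), Ek = EkLog + EkRest → ∀ (E₂ : ℝ) (Γ : ℕ → ℝ),
      (∀ n, 1 ≤ n → n ≤ k → ((univ.filter fun y : Site (F.P p.K) n => toFine n y ∈ gammaRegion s.Ω k n).card : ℝ) ≤ Γ n) →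
      (∀ n, 1 ≤ n → n ≤ k →
        ((univ.filter fun c : TPt (F.P p.K).d (Sect2.domCount (F.P p.K) θ.τ9.M n) =>
            (Sect2.domSites (F.P p.K) θ.τ9.M n (Sect2.cubeDom (F.P p.K) θ.τ9.M n c) ∩
                Sect2.enlT (F.P p.K) (Sect2.zSide (F.P p.K) θ.ν θ.τ9.M (gOfRecord₁₃ F N θ.toStage13Params p) n) 1 (s.Λ n)ᶜ).Nonempty ∧
              ∃ c', (c' = c ∨ TAdj c' c) ∧ (Sect2.domSites (F.P p.K) θ.τ9.M n (Sect2.cubeDom (F.P p.K) θ.τ9.M n c') ∩ s.Ω n).Nonempty).card : ℝ) ≤ Γ n) →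
      (∀ n, 1 ≤ n → n ≤ k → ∑ j ∈ Icc 1 n, (gOfRecord₁₃ F N θ.toStage13Params p j) ^ κ₀ ≤ (gOfRecord₁₃ F N θ.toStage13Params p n) ^ (κ₀ - 6)) →
      (∀ n, 1 ≤ n → n ≤ k → R₁ * (gOfRecord₁₃ F N θ.toStage13Params p n) ^ (κ₀ - 6) ≤ 1) →
      VacuumRestBound EkRest E₂ Γ k →
      Ineq249 ((sect2ActionDataOfRecord F N (FluctV N) p.K (settingOfRecord₁₃ F N θ.toStage13Params p) (θ.rzAt p s) s ((chainWitness θ p σ k).1 s) a Ek).action23 k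
          (Ubg k s W))
        (smearedWilson (invSq (flowOfRun (gOfRecord₁₃ F N θ.toStage13Params p)) (θ.Phih p k s.Ω s.Λ) k) (Ubg k s W)) (-EkLog)
        (E₁ * (1 - L ^ (-β))⁻¹ + 1 + 2 * (θ.s2.lf.B₀ * K₀ (4 * 2 ^ (F.P p.K).d) (2 * (F.P p.K).d)) + E₂) Γ k := by
  obtain ⟨E₁, R₁, hE, hR, hall⟩ := ineq249_action23_chainWitness_of_obligations θ p σ (fun k s => Ubg k s '' Supp k s) hprov hsel hθ hE₀ hB₀ hM hκ hσ hT
    H033 hT2 hβ1 hβ0 hL hκ7 h033 hg (regular_of_bgProvisoΛ θ p Supp Ubg hbg)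
  exact ⟨E₁, R₁, hE, hR, fun k hk s W hW => hall k hk s (Ubg k s W) ⟨W, hW, rfl⟩⟩

end Summit.QuantumFields.YangMills.Theorems.BalabanUVNodesN11Thm2AlongSupplyChainAtBackgrounds

end
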